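import Mathlib
import Literature.Computability.AlgebraicComplexity.NewtonPolygonTau

/-!
# Crux `WordPerSuperPoly` (stmt-ValiantsHypothesis-6626), line `Sketch`, towards stub S2
# (`stub_cancellationSubexp`): cancellation is invisible at tie-free vertices

A sparse bivariate word is a list of letters `(i, j, c, (a, b))` read as the elementary matrix
`E_{ij}(c · X^a Y^b) = Matrix.transvection i j (C c * (X 0 ^ a * X 1 ^ b))` over `ℂ[X, Y]`; its
*all-ones companion* replaces every coefficient `c` by `1`.  Expanding the product, the `(p, q)`
entry is a signed sum over the admissible letter paths from `p` to `q`, and the companion's entry is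
the unsigned sum: its coefficient at an exponent `e` is the NUMBER of paths with exponent sum `e`
(`coeff_multiset`: entry coefficient = sum of a multiset of nonzero path weights, companion
coefficient = its cardinality).  Consequences:

* `support_subset_companion` — cancellation only removes points: `supp(entry w) ⊆ supp(entry w¹)`;
* `coeff_ne_zero_of_companion_eq_one` — a point with a unique path (companion coefficient `1`)
  never cancels;
* `newtonVertexCount_eq_companion_of_generic` (`'` = binder form) — hence if every VERTEX of the companion's Newton
  polygon has a unique optimal path (the generic situation: no ties in the tropical optimisation),
  the word and its companion have the same Newton polygon, so the cancellation factor of stub S2 is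
  `1`.  Any counterexample to S2 must have tied optimal paths at hull vertices at every scale.

Helper file (`--supports stmt-ValiantsHypothesis-6626`) of the line lead; S2 itself stays open.
-/

noncomputable section

-- `Summit.ValiantsHypothesis.ValiantsHypothesis.…` is the tree's mandated single-conjunct layout.
set_option linter.dupNamespace false

namespace Summit.ValiantsHypothesis.ValiantsHypothesis.Theorems.ElementaryWordLengthWordPerSuperPoly

open MvPolynomial Literature.Computability.AlgebraicComplexity

/-- `sparseMat⟦w⟧` (local notation, not a definition): the matrix of a sparse bivariate word. -/
local notation3 (prettyPrint := false) "sparseMat⟦" w "⟧" =>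
  List.prod (List.map (fun l : Fin 3 × Fin 3 × ℂ × (ℕ × ℕ) =>
    Matrix.transvection l.1 l.2.1
      (MvPolynomial.C l.2.2.1 * (MvPolynomial.X 0 ^ l.2.2.2.1 * MvPolynomial.X 1 ^ l.2.2.2.2) :
        MvPolynomial (Fin 2) ℂ)) w)

/-- `comp⟦w⟧` (local notation, not a definition): the all-ones companion word. -/
local notation3 (prettyPrint := false) "comp⟦" w "⟧" =>
  List.map (fun l : Fin 3 × Fin 3 × ℂ × (ℕ × ℕ) => (l.1, l.2.1, (1 : ℂ), l.2.2.2)) w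

/-- `toPt e` (local notation, not a definition): the lattice point of an exponent, as in
`newtonVertexCount`. -/
local notation3 (prettyPrint := false) "toPt" =>
  (fun e : Fin 2 →₀ ℕ => fun i : Fin 2 => ((e i : ℕ) : ℝ))

namespace GenericVertices

/-- A sparse letter `C c * (X^a Y^b)` is the monomial `monomial (single 0 a + single 1 b) c`. [folklore] -/
theorem letter_eq_monomial (c : ℂ) (a b : ℕ) :
    (C c * (X 0 ^ a * X 1 ^ b) : MvPolynomial (Fin 2) ℂ) =
      monomial (Finsupp.single 0 a + Finsupp.single 1 b) c := by
  rw [X_pow_eq_monomial, X_pow_eq_monomial, monomial_mul, C_mul_monomial]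
  simp

/-- **Path-multiset bookkeeping.** For a sparse word with nonzero coefficients, every coefficient
of every entry of its matrix is the sum of a multiset of NONZERO complex numbers (the weights of the
admissible paths with that exponent sum) whose cardinality is the corresponding coefficient of the
all-ones companion. [folklore] -/
theorem coeff_multiset (w : List (Fin 3 × Fin 3 × ℂ × (ℕ × ℕ))) (hw : ∀ l ∈ w, l.2.2.1 ≠ 0) :
    ∀ (p q : Fin 3) (e : Fin 2 →₀ ℕ), ∃ s : Multiset ℂ, (∀ z ∈ s, z ≠ 0) ∧
      coeff e (sparseMat⟦w⟧ p q) = s.sum ∧ coeff e (sparseMat⟦comp⟦w⟧⟧ p q) = (Multiset.card s : ℂ) := by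
  induction w with
  | nil =>
    intro p q e
    simp only [List.map_nil, List.prod_nil]
    by_cases hpq : p = q
    · subst hpq
      by_cases he : e = 0
      · subst he
        refine ⟨{1}, by simp, ?_, ?_⟩ <;> simp
      · refine ⟨0, by simp, ?_, ?_⟩ <;> simp [MvPolynomial.coeff_one, Ne.symm he]
    · refine ⟨0, by simp, ?_, ?_⟩ <;> simp [hpq]
  | cons l w ih =>
    intro p q e
    have hl : l.2.2.1 ≠ 0 := hw l (by simp)
    have hw' : ∀ l' ∈ w, l'.2.2.1 ≠ 0 := fun l' hl' => hw l' (by simp [hl'])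
    replace ih := ih hw'
    simp only [List.map_cons, List.prod_cons]
    set d : Fin 2 →₀ ℕ := Finsupp.single 0 l.2.2.2.1 + Finsupp.single 1 l.2.2.2.2 with hd
    by_cases hp : p = l.1
    · subst hp
      obtain ⟨s₁, hs₁, hsum₁, hcard₁⟩ := ih l.1 q e
      obtain ⟨s₂, hs₂, hsum₂, hcard₂⟩ := ih l.2.1 q (e - d)
      refine ⟨s₁ + (if d ≤ e then s₂.map (fun z => l.2.2.1 * z) else 0), ?_, ?_, ?_⟩
      · intro z hz
        rw [Multiset.mem_add] at hz
        rcases hz with hz | hz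
        · exact hs₁ z hz
        · split_ifs at hz with hde
          · obtain ⟨z', hz', rfl⟩ := Multiset.mem_map.1 hz
            exact mul_ne_zero hl (hs₂ z' hz')
          · simp at hz
      · rw [Matrix.transvection_mul_apply_same, coeff_add, letter_eq_monomial, ← hd,
          coeff_monomial_mul', Multiset.sum_add, hsum₁]
        congr 1
        split_ifs with hde
        · rw [Multiset.sum_map_mul_left, Multiset.map_id', ← hsum₂]
        · simp
      · rw [Matrix.transvection_mul_apply_same, coeff_add, letter_eq_monomial, ← hd,
          coeff_monomial_mul', Multiset.card_add, hcard₁]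
        push_cast
        congr 1
        split_ifs with hde
        · rw [Multiset.card_map, one_mul, ← hcard₂]
        · simp
    · obtain ⟨s₁, hs₁, hsum₁, hcard₁⟩ := ih p q e
      refine ⟨s₁, hs₁, ?_, ?_⟩
      · rw [Matrix.transvection_mul_apply_of_ne (ha := hp), hsum₁]
      · rw [Matrix.transvection_mul_apply_of_ne (ha := hp), hcard₁]

/-- **A point with a unique path never cancels**: if the companion's coefficient at `e` is `1`,
the word's coefficient at `e` is nonzero. [folklore] -/
theorem coeff_ne_zero_of_companion_eq_one (w : List (Fin 3 × Fin 3 × ℂ × (ℕ × ℕ)))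
    (hw : ∀ l ∈ w, l.2.2.1 ≠ 0) (p q : Fin 3) (e : Fin 2 →₀ ℕ)
    (h1 : coeff e (sparseMat⟦comp⟦w⟧⟧ p q) = 1) : coeff e (sparseMat⟦w⟧ p q) ≠ 0 := by
  obtain ⟨s, hs, hsum, hcard⟩ := coeff_multiset w hw p q e
  rw [hcard] at h1
  have hc : Multiset.card s = 1 := by exact_mod_cast h1
  obtain ⟨z, rfl⟩ := Multiset.card_eq_one.1 hc
  rw [hsum, Multiset.sum_singleton]
  exact hs z (Multiset.mem_singleton_self z)

/-- **Cancellation only removes points**: the support of every entry of a word with nonzero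
coefficients is contained in the support of the same entry of its all-ones companion (the full
path-sum set). [folklore] -/
theorem support_subset_companion (w : List (Fin 3 × Fin 3 × ℂ × (ℕ × ℕ)))
    (hw : ∀ l ∈ w, l.2.2.1 ≠ 0) (p q : Fin 3) :
    (sparseMat⟦w⟧ p q).support ⊆ (sparseMat⟦comp⟦w⟧⟧ p q).support := by
  intro e he
  rw [mem_support_iff] at he ⊢
  obtain ⟨s, _, hsum, hcard⟩ := coeff_multiset w hw p q e
  rw [hcard]
  have hs0 : s ≠ 0 := by
    rintro rfl
    rw [hsum, Multiset.sum_zero] at he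
    exact he rfl
  exact_mod_cast (Multiset.card_pos.2 hs0).ne'

/-- **Planar (indeed general) hull bookkeeping**: if `S ⊆ E` are finite and `S` contains every
vertex of `conv E`, then `conv S` and `conv E` have the same vertices (Krein–Milman: `conv E` is
the convex hull of its extreme points). [folklore] -/
theorem extremePoints_convexHull_eq_of_subset {V : Type*} [NormedAddCommGroup V]
    [NormedSpace ℝ V] [FiniteDimensional ℝ V] {S E : Set V} (hE : E.Finite) (hSE : S ⊆ E)
    (hext : (convexHull ℝ E).extremePoints ℝ ⊆ S) :
    (convexHull ℝ S).extremePoints ℝ = (convexHull ℝ E).extremePoints ℝ := by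
  have hS : S.Finite := hE.subset hSE
  have h1 : convexHull ℝ S ⊆ convexHull ℝ E := convexHull_mono hSE
  have hKM := closure_convexHull_extremePoints (hE.isCompact_convexHull ℝ) (convex_convexHull ℝ E)
  have h2 : convexHull ℝ E ⊆ convexHull ℝ S :=
    calc convexHull ℝ E = closure (convexHull ℝ ((convexHull ℝ E).extremePoints ℝ)) := hKM.symm
      _ ⊆ closure (convexHull ℝ S) := closure_mono (convexHull_mono hext)
      _ = convexHull ℝ S := (hS.isCompact_convexHull ℝ).isClosed.closure_eq
  rw [Set.Subset.antisymm h1 h2]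

end GenericVertices

open GenericVertices in
/-- **Cancellation is invisible at tie-free vertices** (binder form, with the local notations). If
all letter coefficients of a sparse bivariate word `w` are nonzero and every vertex of the Newton
polygon of the `(0,2)` entry of its all-ones companion has companion coefficient `1` (a unique optimal
path — the generic, tie-free situation), then the `(0,2)` entries of `w` and of its companion have
Newton polygons with the same number of vertices. [folklore] -/
theorem newtonVertexCount_eq_companion_of_generic' (w : List (Fin 3 × Fin 3 × ℂ × (ℕ × ℕ)))
    (hw : ∀ l ∈ w, l.2.2.1 ≠ 0)
    (hgen : ∀ e : Fin 2 →₀ ℕ, (toPt e) ∈ (convexHull ℝ (toPt ''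
        ((sparseMat⟦comp⟦w⟧⟧ 0 2).support : Set (Fin 2 →₀ ℕ)))).extremePoints ℝ →
      coeff e (sparseMat⟦comp⟦w⟧⟧ 0 2) = 1) :
    newtonVertexCount (sparseMat⟦w⟧ 0 2) = newtonVertexCount (sparseMat⟦comp⟦w⟧⟧ 0 2) := by
  show (Set.extremePoints ℝ (convexHull ℝ (toPt '' ((sparseMat⟦w⟧ 0 2).support : Set (Fin 2 →₀ ℕ))))).ncard =
    (Set.extremePoints ℝ (convexHull ℝ (toPt '' ((sparseMat⟦comp⟦w⟧⟧ 0 2).support : Set (Fin 2 →₀ ℕ))))).ncard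
  congr 1
  refine extremePoints_convexHull_eq_of_subset ((Finset.finite_toSet _).image _)
    (Set.image_mono ?_) ?_
  · exact_mod_cast support_subset_companion w hw 0 2
  · intro x hx
    obtain ⟨e, he, rfl⟩ := extremePoints_convexHull_subset hx
    refine ⟨e, ?_, rfl⟩
    rw [Finset.mem_coe, mem_support_iff]
    exact coeff_ne_zero_of_companion_eq_one w hw 0 2 e (hgen e hx)

/-- **Cancellation is invisible at tie-free vertices** (registered form, notation-free): if all
letter coefficients of a sparse bivariate word `w` are nonzero and every vertex of the Newton
polygon of the `(0,2)` entry of its all-ones companion has companion coefficient `1` (a unique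
optimal path), then the `(0,2)` entries of `w` and of its companion have the same number of Newton
vertices — the cancellation factor of stub S2 (`stub_cancellationSubexp`) is `1` in the generic,
tie-free situation. [folklore] -/
theorem newtonVertexCount_eq_companion_of_generic :
    ∀ w : List (Fin 3 × Fin 3 × ℂ × (ℕ × ℕ)), (∀ l ∈ w, l.2.2.1 ≠ 0) →
      (∀ e : Fin 2 →₀ ℕ,
        (fun i : Fin 2 => ((e i : ℕ) : ℝ)) ∈ (convexHull ℝ
          ((fun e : Fin 2 →₀ ℕ => fun i : Fin 2 => ((e i : ℕ) : ℝ)) ''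
            ((((w.map (fun l => (l.1, l.2.1, (1 : ℂ), l.2.2.2))).map
          (fun l : Fin 3 × Fin 3 × ℂ × (ℕ × ℕ) => Matrix.transvection l.1 l.2.1
            (MvPolynomial.C l.2.2.1 * (MvPolynomial.X 0 ^ l.2.2.2.1 * MvPolynomial.X 1 ^ l.2.2.2.2) :
              MvPolynomial (Fin 2) ℂ))).prod 0 2).support : Set (Fin 2 →₀ ℕ)))).extremePoints ℝ →
        MvPolynomial.coeff e (((w.map (fun l => (l.1, l.2.1, (1 : ℂ), l.2.2.2))).map
          (fun l : Fin 3 × Fin 3 × ℂ × (ℕ × ℕ) => Matrix.transvection l.1 l.2.1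
            (MvPolynomial.C l.2.2.1 * (MvPolynomial.X 0 ^ l.2.2.2.1 * MvPolynomial.X 1 ^ l.2.2.2.2) :
              MvPolynomial (Fin 2) ℂ))).prod 0 2) = 1) →
      newtonVertexCount ((w.map
          (fun l : Fin 3 × Fin 3 × ℂ × (ℕ × ℕ) => Matrix.transvection l.1 l.2.1
            (MvPolynomial.C l.2.2.1 * (MvPolynomial.X 0 ^ l.2.2.2.1 * MvPolynomial.X 1 ^ l.2.2.2.2) :
              MvPolynomial (Fin 2) ℂ))).prod 0 2) =
        newtonVertexCount (((w.map (fun l => (l.1, l.2.1, (1 : ℂ), l.2.2.2))).map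
          (fun l : Fin 3 × Fin 3 × ℂ × (ℕ × ℕ) => Matrix.transvection l.1 l.2.1
            (MvPolynomial.C l.2.2.1 * (MvPolynomial.X 0 ^ l.2.2.2.1 * MvPolynomial.X 1 ^ l.2.2.2.2) :
              MvPolynomial (Fin 2) ℂ))).prod 0 2) :=
  fun w hw hgen => newtonVertexCount_eq_companion_of_generic' w hw hgen

end Summit.ValiantsHypothesis.ValiantsHypothesis.Theorems.ElementaryWordLengthWordPerSuperPoly
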